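import Mathlib
import Literature.Combinatorics.Additive.TripleProductProperty
import Summits.MatrixMultiplication.MatrixMultiplication.Theorems.SnSubsetDichotomyThresholdSubsetTriplesPairFactorisation

/-!
# `SnSubsetDichotomy.ThresholdSubsetTriples`, line `interleaved-subsignature-ascent` — stub `stub_ownerPairNoThird`

Registered stub `stub_ownerPairNoThird` of crux `stmt-MatrixMultiplication-10882` (negative design rule of
census c3a, `Cruxes/ThresholdSubsetTriples/Census-c3a-PairFactorisation.md`): an EXACT chain pair admits no
third class with two elements.  For every level set `L` the owner chain classes
`S_A = subsig (ownerSystem L)` and `S_B = subsig (ownerSystem Lᶜ)` factorise `S_n` exactly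
(`stub_pairFactorisation`, landed in `Theorems/SnSubsetDichotomyThresholdSubsetTriplesPairFactorisation.lean`:
every permutation is `a⁻¹ b` for exactly one pair `(a, b) ∈ S_A × S_B`).  Hence if `(S_A, S_B, U)` has the
triple product property (`Literature.Combinatorics.Additive.TripleProductProperty`, Cohn–Umans 2003, Def. 2.1)
then `|U| ≤ 1`.

Proof.  Let `u, u' ∈ U`.  Pick any `s ∈ S_A`, `t' ∈ S_B` (the factorisation of `1` provides them) and factor
`s⁻¹ (u u'⁻¹)⁻¹ t' = a⁻¹ b` with `a ∈ S_A`, `b ∈ S_B`.  Then `s a⁻¹ · (b t'⁻¹) · (u u'⁻¹) = 1` is a TPP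
relation, so `u = u'`; conclude with `Finset.card_le_one`.  Mathlib + the two tree files only.
-/

-- `Summit.<Summit>.<Problem>` is the tree's mandated summit-side namespace; for this
-- single-conjunct summit the two coincide, so the file silences `dupNamespace`.
set_option linter.dupNamespace false
set_option autoImplicit false

namespace Summit.MatrixMultiplication.MatrixMultiplication.Theorems.ThresholdSubsetTriples

open Literature.Combinatorics.Additive

/-- **No third class for an exact owner pair (stub `stub_ownerPairNoThird`, census c3a).**  If the owner
chain classes `subsig (ownerSystem L)`, `subsig (ownerSystem Lᶜ)` of a level set `L` form, together with a
set `U` of permutations, a triple with the triple product property, then `U` has at most one element: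
the pair already factorises every permutation as `a⁻¹ b` (`stub_pairFactorisation`), so every quotient
`u u'⁻¹` of `U` satisfies a TPP relation and must be trivial. -/
theorem stub_ownerPairNoThird {n : ℕ} (L : Finset (Fin n)) (U : Finset (Equiv.Perm (Fin n)))
    (hT : TripleProductProperty (subsig (ownerSystem L)) (subsig (ownerSystem Lᶜ)) U) : U.card ≤ 1 := by
  rw [Finset.card_le_one]
  intro u hu u' hu'
  -- any elements `s ∈ S_A`, `t' ∈ S_B` (from the factorisation of `1`)
  obtain ⟨⟨s, t'⟩, ⟨hs, ht', -⟩, -⟩ := stub_pairFactorisation L 1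
  -- factor `s⁻¹ (u u'⁻¹)⁻¹ t'` through the pair
  obtain ⟨⟨a, b⟩, ⟨ha, hb, hab⟩, -⟩ := stub_pairFactorisation L (s⁻¹ * (u * u'⁻¹)⁻¹ * t')
  have key : s * a⁻¹ * (b * t'⁻¹) * (u * u'⁻¹) = 1 := by
    calc s * a⁻¹ * (b * t'⁻¹) * (u * u'⁻¹) = s * (a⁻¹ * b) * t'⁻¹ * (u * u'⁻¹) := by group
      _ = s * (s⁻¹ * (u * u'⁻¹)⁻¹ * t') * t'⁻¹ * (u * u'⁻¹) := by rw [hab]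
      _ = 1 := by group
  exact (hT s hs a ha b hb t' ht' u hu u' hu' key).2.2

end Summit.MatrixMultiplication.MatrixMultiplication.Theorems.ThresholdSubsetTriples
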